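import Literature.RepresentationTheory.CompactGroups.TorusWeightSpaces
import Literature.RepresentationTheory.CompactGroups.CharacterMultiplicity
import Literature.RepresentationTheory.CompactGroups.WeylIntegrationUnitary
import Literature.RepresentationTheory.CompactGroups.UnitaryGroupCharacters
import Literature.Analysis.Fourier.TrigonometricPolynomialBoxIntegrals
import HarnessLib

/-!
# The character of an irreducible representation of `U(2)` on the diagonal torus, I:
# `(z − w)·χ(diag(z, w)) = z^{A₀} w^{A₁} − z^{A₁} w^{A₀}` (Weyl's integral formula + Schur orthogonality + Parseval)

Topic `RepresentationTheory/CompactGroups`; namespace `Literature.RepresentationTheory.CompactGroups.UnitaryTwo`.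
Theorems only (no definition, no named fact, no instance, no `sorry`).  This is the analytic half of the `U(2)` case of
WEYL'S CHARACTER FORMULA in its uniqueness direction (Bröcker–tom Dieck VI (1.7) [BrockerTomDieck1985]; Weyl's
original argument, cf. II (4.11)–(4.12), IV (1.11)): for an irreducible unitary norm-continuous representation `τ` of
`U(2) = Matrix.unitaryGroup (Fin 2) ℂ` on a finite-dimensional inner-product space `E`, with character `χ = Schur.character τ`,

1. (`character_diagonalTorusHom_eq_sum`) on the torus `χ(diag u) = Σ_m d_m u^m` (`u^m = ∏ᵢ uᵢ^{mᵢ}`), `d_m = dim E_m` the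
   weight multiplicities (★ `TorusWeights.trace_eq_sum_finrank_mul_prod_zpow`), symmetric under the Weyl group
   `d_{m∘swap} = d_m` (`finrank_weightSpace_comp_swap`: `τ(s)` maps `E_m` onto `E_{m∘swap}`);
2. (`sum_sq_antisymmetrization_eq_two`) with `e_p := d_{p−ε₀} − d_{p−ε₁}` — the coefficients of
   `(u₀ − u₁)·χ(diag u) = Σ_p e_p u^p` — one has `Σ_p e_p² = 2`: Schur's `∫_{U(2)} |χ|² = 1`
   (★ `Schur.integral_conj_character_mul_character`), Weyl's integral formula for `U(2)`
   (★ `WeylIntegration.lintegral_haarProbability_unitaryGroup_eq_lintegral_diagonalTorus`, weight `|u₀ − u₁|²/2`, and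
   ★ `lintegral_haarProbability_diagonalTorus_eq` for the angle chart) and Parseval on `(−π, π]²`
   (★ `TorusBox.integral_box_norm_sq_trigPoly`);
3. (`exists_sub_mul_character_eq`) since `e` is integer valued and ANTISYMMETRIC under `swap`, `e = δ_A − δ_{A∘swap}` for
   one `A` with `A 0 ≠ A 1`, i.e. **`(u₀ − u₁) χ(diag u) = u^A − u^{A∘swap}`** on the torus, and the weight `A − ε₀`
   occurs in `E` (`e_A = 1` forces `d_{A−ε₀} ≥ 1`).

The sequel `UnitaryGroupTwoIrreducibleCharacters` divides by `u₀ − u₁` and reads off `χ(diag(z,w)) = (zw)^b Σ_{j≤a} z^j w^{a−j}`,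
`dim E = a + 1`, the highest weight, and "same `(a, b)` ⇒ equivalent".  Written for the `hodgecm-mathlib` cell (road HC,
node H4b: the `K̂`-dictionary for `K = U(2) × U(1) ⊂ U(2,1)`); generic.

## References
* T. Bröcker, T. tom Dieck, *Representations of Compact Lie Groups*, GTM 98 (1985), II (4.11)–(4.12), (8.2), IV (1.11),
  VI (1.7) [BrockerTomDieck1985].
* A. W. Knapp, *Representation Theory of Semisimple Groups* (1986), proof of Thm. 10.2 (the `K`-types of `U(2,1)`) [Knapp1986].
-/

set_option autoImplicit false

noncomputable section

open MeasureTheory Complex Module Module.End Finset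
open Literature.LinearAlgebra.Matrix (diagonalTorus diagonalTorusHom coe_diagonalTorusHom_apply continuous_diagonalTorusHom)
open Literature.MathematicalPhysics.QuantumFieldTheory (haarProbability)
open Literature.Analysis.Fourier
open scoped InnerProductSpace ComplexConjugate Real ENNReal

namespace Literature.RepresentationTheory.CompactGroups

namespace UnitaryTwo

variable {E : Type*} [NormedAddCommGroup E] [InnerProductSpace ℂ E] [FiniteDimensional ℂ E]
variable (τ : ContRepresentation ℂ (Matrix.unitaryGroup (Fin 2) ℂ) E)

/-! ### §1 The torus restriction: weight multiplicities and the character on the torus -/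

omit [FiniteDimensional ℂ E] in
/-- The torus action `u ↦ τ(diag u)` as a homomorphism `U(1)² →* End E` has continuous orbit maps when `τ` is
norm-continuous. [cite: BrockerTomDieck1985, II (8.2)] -/
theorem continuous_torus_apply (hτ : Continuous (τ : Matrix.unitaryGroup (Fin 2) ℂ → E →L[ℂ] E)) (x : E) :
    Continuous fun u : Fin 2 → Circle => (τ.toRepresentation.comp (diagonalTorusHom (Fin 2))) u x :=
  (ContinuousLinearMap.apply ℂ E x).continuous.comp (hτ.comp (continuous_diagonalTorusHom (Fin 2)))

/-- **The character on the torus is the weight-multiplicity polynomial**: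
`χ_τ(diag u) = Σ_{m : E_m ≠ 0} dim(E_m) · ∏ᵢ uᵢ^{mᵢ}`. [cite: BrockerTomDieck1985, II (8.2)] -/
theorem character_diagonalTorusHom_eq_sum (hτ : Continuous (τ : Matrix.unitaryGroup (Fin 2) ℂ → E →L[ℂ] E))
    (u : Fin 2 → Circle) :
    Schur.character τ (diagonalTorusHom (Fin 2) u) =
      ∑ m ∈ (TorusWeights.finite_weightSpace_ne_bot (τ.toRepresentation.comp (diagonalTorusHom (Fin 2)))).toFinset,
        (finrank ℂ (⨅ v : Fin 2 → Circle, eigenspace ((τ.toRepresentation.comp (diagonalTorusHom (Fin 2))) v)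
            (∏ i, (v i : ℂ) ^ m i) : Submodule ℂ E) : ℂ) * ∏ i, (u i : ℂ) ^ m i :=
  TorusWeights.trace_eq_sum_finrank_mul_prod_zpow _ (continuous_torus_apply τ hτ) u

/-- `diag(u) · s = s · diag(u ∘ swap)` for the transposition `s ∈ U(2)`. [cite: BrockerTomDieck1985, IV (3.3)] -/
theorem diagonalTorusHom_mul_swapU (u : Fin 2 → Circle) :
    diagonalTorusHom (Fin 2) u * UnitaryGroupChar.swapU 0 1 =
      UnitaryGroupChar.swapU 0 1 * diagonalTorusHom (Fin 2) (u ∘ Equiv.swap 0 1) := by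
  have h := UnitaryGroupChar.swapU_mul_diagU_mul_inv (0 : Fin 2) 1 (u ∘ Equiv.swap 0 1)
  have hid : (u ∘ Equiv.swap 0 1) ∘ Equiv.swap 0 1 = u := by
    funext i; simp only [Function.comp_apply, Equiv.swap_apply_self]
  rw [hid] at h
  have hdiag : ∀ d : Fin 2 → Circle, UnitaryGroupChar.diagU d = diagonalTorusHom (Fin 2) d := fun d => Subtype.ext rfl
  rw [hdiag, hdiag] at h
  rw [← h, inv_mul_cancel_right]

/-- `∏ᵢ (u (swap i))^{mᵢ} = ∏ᵢ uᵢ^{m (swap i)}`. [folklore] -/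
private theorem prod_comp_swap (u : Fin 2 → Circle) (m : Fin 2 → ℤ) :
    (∏ i, ((u ∘ Equiv.swap 0 1) i : ℂ) ^ m i) = ∏ i, (u i : ℂ) ^ (m ∘ Equiv.swap 0 1) i := by
  simp only [Fin.prod_univ_two, Function.comp_apply, Equiv.swap_apply_left, Equiv.swap_apply_right, mul_comm]

omit [FiniteDimensional ℂ E] in
/-- `τ(s)` maps the weight space `E_m` into `E_{m∘swap}`. [cite: BrockerTomDieck1985, IV (3.3)] -/
theorem map_swapU_weightSpace_le (m : Fin 2 → ℤ) :
    Submodule.map ((τ.toRepresentation) (UnitaryGroupChar.swapU 0 1))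
        (⨅ v : Fin 2 → Circle, eigenspace ((τ.toRepresentation.comp (diagonalTorusHom (Fin 2))) v)
          (∏ i, (v i : ℂ) ^ m i)) ≤
      ⨅ v : Fin 2 → Circle, eigenspace ((τ.toRepresentation.comp (diagonalTorusHom (Fin 2))) v)
        (∏ i, (v i : ℂ) ^ (m ∘ Equiv.swap 0 1) i) := by
  refine Submodule.map_le_iff_le_comap.mpr fun x hx => ?_
  rw [Submodule.mem_comap]
  have hx' := (TorusWeights.mem_weightSpace_iff _ m x).mp hx
  refine (TorusWeights.mem_weightSpace_iff _ _ _).mpr fun v => ?_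
  change (τ.toRepresentation) (diagonalTorusHom (Fin 2) v) ((τ.toRepresentation) (UnitaryGroupChar.swapU 0 1) x) = _
  rw [← Module.End.mul_apply, ← map_mul, diagonalTorusHom_mul_swapU, map_mul, Module.End.mul_apply]
  have h2 := hx' (v ∘ Equiv.swap 0 1)
  change (τ.toRepresentation) (diagonalTorusHom (Fin 2) (v ∘ Equiv.swap 0 1)) x = _ at h2
  rw [h2, map_smul, prod_comp_swap]

/-- **The weight multiplicities are symmetric under the Weyl group**: `dim E_{m∘swap} = dim E_m`.
[cite: BrockerTomDieck1985, IV (3.3)] -/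
theorem finrank_weightSpace_comp_swap (m : Fin 2 → ℤ) :
    finrank ℂ (⨅ v : Fin 2 → Circle, eigenspace ((τ.toRepresentation.comp (diagonalTorusHom (Fin 2))) v)
        (∏ i, (v i : ℂ) ^ (m ∘ Equiv.swap 0 1) i) : Submodule ℂ E) =
      finrank ℂ (⨅ v : Fin 2 → Circle, eigenspace ((τ.toRepresentation.comp (diagonalTorusHom (Fin 2))) v)
        (∏ i, (v i : ℂ) ^ m i) : Submodule ℂ E) := by
  -- `τ(s)` as a linear equivalence (`s² = 1`)
  set s := UnitaryGroupChar.swapU (0 : Fin 2) 1 with hs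
  have hss : s * s = 1 := by
    apply Subtype.ext
    change Matrix.swap ℂ (0 : Fin 2) 1 * Matrix.swap ℂ 0 1 = 1
    exact Matrix.swap_mul_self 0 1
  let e : E ≃ₗ[ℂ] E :=
    { toLinearMap := (τ.toRepresentation) s
      invFun := (τ.toRepresentation) s
      left_inv := fun x => by
        change ((τ.toRepresentation) s * (τ.toRepresentation) s) x = x
        rw [← map_mul, hss, map_one, Module.End.one_apply]
      right_inv := fun x => by
        change ((τ.toRepresentation) s * (τ.toRepresentation) s) x = x
        rw [← map_mul, hss, map_one, Module.End.one_apply] }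
  have hle := fun m' => map_swapU_weightSpace_le τ m'
  apply le_antisymm
  · -- `τ(s) E_{m∘swap} ⊆ E_{m∘swap∘swap} = E_m`
    have h := Submodule.finrank_mono (hle (m ∘ Equiv.swap 0 1))
    have hid : (m ∘ Equiv.swap 0 1) ∘ Equiv.swap 0 1 = m := by
      funext i; simp only [Function.comp_apply, Equiv.swap_apply_self]
    rw [hid] at h
    rwa [show Submodule.map ((τ.toRepresentation) s) _ = Submodule.map (e : E →ₗ[ℂ] E) _ from rfl,
      LinearEquiv.finrank_map_eq] at h
  · have h := Submodule.finrank_mono (hle m)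
    rwa [show Submodule.map ((τ.toRepresentation) s) _ = Submodule.map (e : E →ₗ[ℂ] E) _ from rfl,
      LinearEquiv.finrank_map_eq] at h

/-! ### §2 The antisymmetrised multiplicities `e_p = d_{p−ε₀} − d_{p−ε₁}` and `Σ_p e_p² = 2` -/

section Analytic

/-- The character is continuous. [cite: BrockerTomDieck1985, II (4.10)] -/
theorem continuous_character (hτ : Continuous (τ : Matrix.unitaryGroup (Fin 2) ℂ → E →L[ℂ] E)) :
    Continuous (Schur.character τ) := by
  have h : Schur.character τ = fun g => ∑ i, ⟪stdOrthonormalBasis ℂ E i, τ g (stdOrthonormalBasis ℂ E i)⟫_ℂ := by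
    funext g; exact Schur.character_eq_sum_inner (stdOrthonormalBasis ℂ E) g
  rw [h]
  exact continuous_finsetSum _ fun i _ => Schur.continuous_inner_apply hτ _ _

/-- **Schur in `ℝ≥0∞` form**: `∫⁻_{U(2)} |χ_τ|² dHaar = 1` for irreducible unitary `τ`. [cite: BrockerTomDieck1985, II (4.11)] -/
theorem lintegral_norm_sq_character_eq_one (hτ : Continuous (τ : Matrix.unitaryGroup (Fin 2) ℂ → E →L[ℂ] E))
    [τ.toRepresentation.IsIrreducible]
    (hu : ∀ (g : Matrix.unitaryGroup (Fin 2) ℂ) (v w : E), ⟪τ g v, τ g w⟫_ℂ = ⟪v, w⟫_ℂ) :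
    ∫⁻ g, ENNReal.ofReal (‖Schur.character τ g‖ ^ 2) ∂haarProbability (Matrix.unitaryGroup (Fin 2) ℂ) = 1 := by
  haveI : IsProbabilityMeasure (haarProbability (Matrix.unitaryGroup (Fin 2) ℂ)) :=
    ⟨by simpa [haarProbability] using Measure.haarMeasure_self (G := Matrix.unitaryGroup (Fin 2) ℂ) (K₀ := ⊤)⟩
  have h := Schur.integral_conj_character_mul_character (haarProbability (Matrix.unitaryGroup (Fin 2) ℂ)) hτ hu
  simp_rw [Complex.conj_mul', ← Complex.ofReal_pow] at h
  rw [integral_complex_ofReal, ← Complex.ofReal_one, Complex.ofReal_inj] at h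
  have hint : Integrable (fun g => ‖Schur.character τ g‖ ^ 2) (haarProbability (Matrix.unitaryGroup (Fin 2) ℂ)) :=
    ((continuous_character τ hτ).norm.pow 2).integrable_of_hasCompactSupport (HasCompactSupport.of_compactSpace _)
  rw [← ofReal_integral_eq_lintegral_ofReal hint (Filter.Eventually.of_forall fun g => by positivity), h,
    ENNReal.ofReal_one]

/-- `(e^{iθ_j})^{m_j}` products are the trigonometric monomials of the box chart:
`∏_j (e^{iθ_j})^{m_j} = e^{i Σ_j m_j θ_j}`. [cite: BrockerTomDieck1985, II (8.4)] -/
theorem prod_coe_exp_zpow (m : Fin 2 → ℤ) (θ : Fin 2 → ℝ) :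
    (∏ i, ((Circle.exp (θ i) : Circle) : ℂ) ^ m i) = cexp ((∑ j, (m j : ℂ) * (θ j : ℂ)) * I) := by
  rw [Finset.sum_mul, Complex.exp_sum]
  refine Finset.prod_congr rfl fun i _ => ?_
  rw [Circle.coe_exp, ← Complex.exp_int_mul, mul_assoc]

/-- The Weyl weight of `U(2)` at `diag(e^{iθ})` times `|χ|²` is `|(e^{iθ₀} − e^{iθ₁}) χ(diag e^{iθ})|² / 2`.
[cite: BrockerTomDieck1985, IV (1.11)] -/
theorem weylWeight_torusPt_mul (θ : Fin 2 → ℝ) (c : ℂ) :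
    WeylIntegration.weylWeight (WeylIntegration.torusPt θ) * ENNReal.ofReal (‖c‖ ^ 2) =
      ENNReal.ofReal (‖(cexp (θ 0 * I) - cexp (θ 1 * I)) * c‖ ^ 2 / 2) := by
  rw [WeylIntegration.weylWeight]
  have hmat : ∀ i, (((WeylIntegration.torusPt θ : diagonalTorus (Fin 2)) : Matrix.unitaryGroup (Fin 2) ℂ) :
      Matrix (Fin 2) (Fin 2) ℂ) i i = cexp (θ i * I) := fun i => by
    rw [WeylIntegration.coe_torusPt, Matrix.diagonal_apply_eq]
  simp_rw [hmat]
  have h0 : (univ : Finset (Fin 2)).erase 0 = {1} := by decide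
  have h1 : (univ : Finset (Fin 2)).erase 1 = {0} := by decide
  rw [Fin.prod_univ_two, h0, h1, prod_singleton, prod_singleton, Fintype.card_fin, norm_sub_rev (cexp (θ 1 * I)),
    ← ENNReal.ofReal_mul (by positivity)]
  congr 1
  rw [norm_mul, mul_pow]
  ring

/-- **THE WEYL–SCHUR IDENTITY IN THE ANGLE CHART**:
`∫_{(−π,π]²} |(e^{iθ₀} − e^{iθ₁}) χ_τ(diag e^{iθ})|² dθ = 2·(2π)²` for irreducible unitary `τ`.
[cite: BrockerTomDieck1985, IV (1.11)] [cite: BrockerTomDieck1985, II (4.11)] -/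
theorem integral_box_norm_sq_sub_mul_character (hτ : Continuous (τ : Matrix.unitaryGroup (Fin 2) ℂ → E →L[ℂ] E))
    [τ.toRepresentation.IsIrreducible]
    (hu : ∀ (g : Matrix.unitaryGroup (Fin 2) ℂ) (v w : E), ⟪τ g v, τ g w⟫_ℂ = ⟪v, w⟫_ℂ) :
    ∫ θ in Set.pi Set.univ fun _ : Fin 2 => Set.Ioc (-π) π,
        ‖(cexp (θ 0 * I) - cexp (θ 1 * I)) *
          Schur.character τ (diagonalTorusHom (Fin 2) fun j => Circle.exp (θ j))‖ ^ 2 = 2 * (2 * π) ^ 2 := by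
  -- the class function `|χ|²`
  set F : Matrix.unitaryGroup (Fin 2) ℂ → ℝ≥0∞ := fun g => ENNReal.ofReal (‖Schur.character τ g‖ ^ 2) with hF
  have hFm : Measurable F :=
    ENNReal.measurable_ofReal.comp ((continuous_character τ hτ).norm.pow 2).measurable
  have hcl : ∀ g u : Matrix.unitaryGroup (Fin 2) ℂ, F (g * u * g⁻¹) = F u := fun g u => by
    simp only [hF, Schur.character_conj]
  have h1 := lintegral_norm_sq_character_eq_one τ hτ hu
  rw [WeylIntegration.lintegral_haarProbability_unitaryGroup_eq_lintegral_diagonalTorus hFm hcl,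
    WeylIntegration.lintegral_haarProbability_diagonalTorus_eq (n := Fin 2)
      (f := fun t => WeylIntegration.weylWeight t * F (t : Matrix.unitaryGroup (Fin 2) ℂ))
      (WeylIntegration.measurable_weylWeight.mul (hFm.comp measurable_subtype_coe))] at h1
  -- the integrand in the chart
  set g : (Fin 2 → ℝ) → ℂ := fun θ => (cexp (θ 0 * I) - cexp (θ 1 * I)) *
    Schur.character τ (diagonalTorusHom (Fin 2) fun j => Circle.exp (θ j)) with hg
  have hpt : ∀ θ : Fin 2 → ℝ, WeylIntegration.weylWeight (WeylIntegration.torusPt θ) *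
      F ((WeylIntegration.torusPt θ : diagonalTorus (Fin 2)) : Matrix.unitaryGroup (Fin 2) ℂ) =
        ENNReal.ofReal (‖g θ‖ ^ 2 / 2) := fun θ => by
    rw [hF]
    exact weylWeight_torusPt_mul θ _
  simp_rw [hpt] at h1
  -- continuity and integrability of `g`
  have hgc : Continuous g := by
    refine Continuous.mul ?_ ((continuous_character τ hτ).comp ((continuous_diagonalTorusHom (Fin 2)).comp
      (continuous_pi fun j => Circle.exp.continuous.comp (continuous_apply j))))
    exact (Complex.continuous_exp.comp ((Complex.continuous_ofReal.comp (continuous_apply 0)).mul continuous_const)).sub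
      (Complex.continuous_exp.comp ((Complex.continuous_ofReal.comp (continuous_apply 1)).mul continuous_const))
  have hint : IntegrableOn (fun θ => ‖g θ‖ ^ 2 / 2) (Set.pi Set.univ fun _ : Fin 2 => Set.Ioc (-π) π) :=
    TorusBox.integrableOn_box_of_continuous ((hgc.norm.pow 2).div_const 2)
  rw [← ofReal_integral_eq_lintegral_ofReal hint (Filter.Eventually.of_forall fun θ => by positivity)] at h1
  -- solve for the integral
  have hA : (ENNReal.ofReal (2 * π) ^ Fintype.card (Fin 2)) ≠ 0 :=
    pow_ne_zero _ ((ENNReal.ofReal_pos.mpr Real.two_pi_pos).ne')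
  have hA' : (ENNReal.ofReal (2 * π) ^ Fintype.card (Fin 2)) ≠ ⊤ := ENNReal.pow_ne_top ENNReal.ofReal_ne_top
  have h2 : ENNReal.ofReal (∫ θ in Set.pi Set.univ fun _ : Fin 2 => Set.Ioc (-π) π, ‖g θ‖ ^ 2 / 2) =
      ENNReal.ofReal (2 * π) ^ Fintype.card (Fin 2) := by
    have := congrArg (fun x => ENNReal.ofReal (2 * π) ^ Fintype.card (Fin 2) * x) h1
    simp only [mul_one] at this
    rw [← mul_assoc, ENNReal.mul_inv_cancel hA hA', one_mul] at this
    exact this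
  rw [Fintype.card_fin, ← ENNReal.ofReal_pow (by positivity), ENNReal.ofReal_eq_ofReal_iff
    (integral_nonneg fun θ => by positivity) (by positivity)] at h2
  have h3 : ∫ θ in Set.pi Set.univ fun _ : Fin 2 => Set.Ioc (-π) π, ‖g θ‖ ^ 2 / 2 =
      (∫ θ in Set.pi Set.univ fun _ : Fin 2 => Set.Ioc (-π) π, ‖g θ‖ ^ 2) / 2 := integral_div 2 _
  rw [h3] at h2
  linarith

end Analytic

/-! ### §3 The antisymmetrised multiplicity function and its support -/

/-- Reindexing: `u₀ · Σ_{m ∈ S} d_m u^m = Σ_{p ∈ S + ε} d_{p−ε} u^p` for a translate `ε` (here `d` vanishes off `S`).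
[cite: BrockerTomDieck1985, VI (1.7)] -/
theorem sum_mul_prod_zpow_shift (S : Finset (Fin 2 → ℤ)) (d : (Fin 2 → ℤ) → ℕ) (ε : Fin 2 → ℤ)
    (Q : Finset (Fin 2 → ℤ)) (hQ : S.image (· + ε) ⊆ Q) (hd : ∀ m, m ∉ S → d m = 0) (u : Fin 2 → Circle) :
    (∏ i, (u i : ℂ) ^ ε i) * ∑ m ∈ S, (d m : ℂ) * ∏ i, (u i : ℂ) ^ m i =
      ∑ p ∈ Q, (d (p - ε) : ℂ) * ∏ i, (u i : ℂ) ^ p i := by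
  have hne : ∀ i, (u i : ℂ) ≠ 0 := fun i => Circle.coe_ne_zero (u i)
  rw [Finset.mul_sum]
  have hinj : Set.InjOn (· + ε) (S : Set (Fin 2 → ℤ)) := fun a _ b _ h => add_right_cancel h
  rw [← Finset.sum_subset hQ, Finset.sum_image hinj]
  · refine Finset.sum_congr rfl fun m _ => ?_
    rw [add_sub_cancel_right, mul_left_comm, ← Finset.prod_mul_distrib]
    congr 1
    refine Finset.prod_congr rfl fun i _ => ?_
    rw [Pi.add_apply, zpow_add₀ (hne i), mul_comm]
  · intro p _ hp
    have : p - ε ∉ S := by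
      intro h
      exact hp (Finset.mem_image.mpr ⟨p - ε, h, sub_add_cancel p ε⟩)
    rw [hd _ this, Nat.cast_zero, zero_mul]

/-- **Integer antisymmetric coefficients with `Σ e² = 2` are `δ_A − δ_{A∘swap}`**: if `e : ℤ² → ℤ` vanishes off the
finite set `Q`, satisfies `e(p∘swap) = −e(p)` and `Σ_{p ∈ Q} e_p² = 2`, then `e = δ_A − δ_{A∘swap}` for some `A` with
`e_A = 1` (so `A ≠ A∘swap`). [cite: BrockerTomDieck1985, VI (1.7)] -/
theorem eq_indicator_sub_indicator_of_sum_sq_eq_two (Q : Finset (Fin 2 → ℤ)) (e : (Fin 2 → ℤ) → ℤ)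
    (hQ : ∀ p, p ∉ Q → e p = 0) (hanti : ∀ p, e (p ∘ Equiv.swap 0 1) = -e p) (hsum : ∑ p ∈ Q, e p ^ 2 = 2) :
    ∃ A : Fin 2 → ℤ, e A = 1 ∧ A ∘ Equiv.swap 0 1 ≠ A ∧
      ∀ p, e p = (if p = A then 1 else 0) - (if p = A ∘ Equiv.swap 0 1 then 1 else 0) := by
  classical
  -- some coefficient is non-zero, and after a swap it is positive
  obtain ⟨p₀, hp₀Q, hp₀⟩ : ∃ p₀ ∈ Q, e p₀ ≠ 0 := by
    by_contra h
    push Not at h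
    have : ∑ p ∈ Q, e p ^ 2 = 0 := Finset.sum_eq_zero fun p hp => by rw [h p hp, zero_pow two_ne_zero]
    omega
  obtain ⟨A, hA⟩ : ∃ A, 0 < e A := by
    rcases lt_or_gt_of_ne hp₀ with h | h
    · exact ⟨p₀ ∘ Equiv.swap 0 1, by rw [hanti]; omega⟩
    · exact ⟨p₀, h⟩
  have hAσ : e (A ∘ Equiv.swap 0 1) = -e A := hanti A
  have hne : A ∘ Equiv.swap 0 1 ≠ A := by
    intro h; rw [h] at hAσ; omega
  have hAQ : A ∈ Q := by by_contra h; have := hQ A h; omega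
  have hAσQ : A ∘ Equiv.swap 0 1 ∈ Q := by by_contra h; have := hQ _ h; omega
  -- split the sum at `A` and `A∘swap`
  have hsplit : ∑ p ∈ Q, e p ^ 2 =
      e A ^ 2 + (e (A ∘ Equiv.swap 0 1) ^ 2 + ∑ p ∈ (Q.erase A).erase (A ∘ Equiv.swap 0 1), e p ^ 2) := by
    rw [← Finset.add_sum_erase Q _ hAQ, ← Finset.add_sum_erase (Q.erase A) _ (Finset.mem_erase.mpr ⟨hne, hAσQ⟩)]
  have hrest_nonneg : 0 ≤ ∑ p ∈ (Q.erase A).erase (A ∘ Equiv.swap 0 1), e p ^ 2 :=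
    Finset.sum_nonneg fun p _ => sq_nonneg _
  have hA1 : e A = 1 := by nlinarith
  have hrest : ∑ p ∈ (Q.erase A).erase (A ∘ Equiv.swap 0 1), e p ^ 2 = 0 := by nlinarith
  have hzero : ∀ p ∈ (Q.erase A).erase (A ∘ Equiv.swap 0 1), e p = 0 := by
    intro p hp
    have := (Finset.sum_eq_zero_iff_of_nonneg fun q _ => sq_nonneg (e q)).mp hrest p hp
    exact pow_eq_zero_iff two_ne_zero |>.mp this
  refine ⟨A, hA1, hne, fun p => ?_⟩
  by_cases hpA : p = A
  · subst hpA; rw [if_pos rfl, if_neg hne.symm, hA1]; ring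
  by_cases hpσ : p = A ∘ Equiv.swap 0 1
  · subst hpσ; rw [if_neg hpA, if_pos rfl, hAσ, hA1]; ring
  rw [if_neg hpA, if_neg hpσ, sub_zero]
  by_cases hpQ : p ∈ Q
  · exact hzero p (Finset.mem_erase.mpr ⟨hpσ, Finset.mem_erase.mpr ⟨hpA, hpQ⟩⟩)
  · exact hQ p hpQ

/-! ### §4 `(u₀ − u₁) χ(diag u) = u^A − u^{A∘swap}` -/

section Main

/-- **THE CHARACTER OF AN IRREDUCIBLE REPRESENTATION OF `U(2)` ON THE TORUS, NUMERATOR FORM**: there is `A ∈ ℤ²` with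
`A 0 ≠ A 1` such that `(u₀ − u₁) · χ_τ(diag u) = u^A − u^{A∘swap}` for all `u` in the diagonal torus, and the weight
`A − ε₀` OCCURS in `E` (a non-zero vector on which the torus acts by `u ↦ u₀^{A₀−1} u₁^{A₁}`).  Weyl's character
formula for `U(2)`, uniqueness direction. [cite: BrockerTomDieck1985, VI (1.7)] [cite: Knapp1986, Thm. 10.2 (proof)] -/
theorem exists_sub_mul_character_eq (hτ : Continuous (τ : Matrix.unitaryGroup (Fin 2) ℂ → E →L[ℂ] E))
    [τ.toRepresentation.IsIrreducible]
    (hu : ∀ (g : Matrix.unitaryGroup (Fin 2) ℂ) (v w : E), ⟪τ g v, τ g w⟫_ℂ = ⟪v, w⟫_ℂ) :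
    ∃ A : Fin 2 → ℤ, A 0 ≠ A 1 ∧
      (∀ u : Fin 2 → Circle, ((u 0 : ℂ) - u 1) * Schur.character τ (diagonalTorusHom (Fin 2) u) =
        (∏ i, (u i : ℂ) ^ A i) - ∏ i, (u i : ℂ) ^ (A ∘ Equiv.swap 0 1) i) ∧
      ∃ x : E, x ≠ 0 ∧ ∀ u : Fin 2 → Circle,
        τ (diagonalTorusHom (Fin 2) u) x = ((u 0 : ℂ) ^ (A 0 - 1) * (u 1 : ℂ) ^ A 1) • x := by
  classical
  -- the torus data
  set ρ : (Fin 2 → Circle) →* Module.End ℂ E := τ.toRepresentation.comp (diagonalTorusHom (Fin 2)) with hρ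
  have hρc : ∀ x : E, Continuous fun u => ρ u x := continuous_torus_apply τ hτ
  set W : (Fin 2 → ℤ) → Submodule ℂ E := fun m => ⨅ v : Fin 2 → Circle, eigenspace (ρ v) (∏ i, (v i : ℂ) ^ m i)
    with hW
  set d : (Fin 2 → ℤ) → ℕ := fun m => finrank ℂ (W m) with hd
  set S : Finset (Fin 2 → ℤ) := (TorusWeights.finite_weightSpace_ne_bot ρ).toFinset with hS
  have hmemS : ∀ m, m ∈ S ↔ W m ≠ ⊥ := fun m => by rw [hS, Set.Finite.mem_toFinset]; rfl
  have hdS : ∀ m, m ∉ S → d m = 0 := fun m hm => by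
    rw [hmemS, not_ne_iff] at hm
    exact Submodule.finrank_eq_zero.mpr hm
  have hchar : ∀ u, Schur.character τ (diagonalTorusHom (Fin 2) u) = ∑ m ∈ S, (d m : ℂ) * ∏ i, (u i : ℂ) ^ m i :=
    fun u => character_diagonalTorusHom_eq_sum τ hτ u
  have hdsymm : ∀ m, d (m ∘ Equiv.swap 0 1) = d m := fun m => finrank_weightSpace_comp_swap τ m
  -- the antisymmetrised coefficients
  let ε₀ : Fin 2 → ℤ := Pi.single 0 1
  let ε₁ : Fin 2 → ℤ := Pi.single 1 1
  set e : (Fin 2 → ℤ) → ℤ := fun p => (d (p - ε₀) : ℤ) - d (p - ε₁) with he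
  set Q : Finset (Fin 2 → ℤ) := S.image (· + ε₀) ∪ S.image (· + ε₁) with hQ
  have heQ : ∀ p, p ∉ Q → e p = 0 := by
    intro p hp
    rw [hQ, Finset.mem_union, not_or] at hp
    have h0 : p - ε₀ ∉ S := fun h => hp.1 (Finset.mem_image.mpr ⟨_, h, sub_add_cancel p ε₀⟩)
    have h1 : p - ε₁ ∉ S := fun h => hp.2 (Finset.mem_image.mpr ⟨_, h, sub_add_cancel p ε₁⟩)
    simp only [he, hdS _ h0, hdS _ h1, Nat.cast_zero, sub_zero]
  have hε : ∀ p : Fin 2 → ℤ, (p ∘ Equiv.swap 0 1) - ε₀ = (p - ε₁) ∘ Equiv.swap 0 1 ∧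
      (p ∘ Equiv.swap 0 1) - ε₁ = (p - ε₀) ∘ Equiv.swap 0 1 := fun p => by
    constructor <;> funext i <;> fin_cases i <;> simp [ε₀, ε₁]
  have hanti : ∀ p, e (p ∘ Equiv.swap 0 1) = -e p := fun p => by
    simp only [he]
    rw [(hε p).1, (hε p).2, hdsymm, hdsymm]
    ring
  -- `(u₀ − u₁) χ(diag u) = Σ_{p ∈ Q} e_p u^p`
  have hu0 : ∀ u : Fin 2 → Circle, (∏ i, (u i : ℂ) ^ ε₀ i) = u 0 := fun u => by
    simp [Fin.prod_univ_two, ε₀]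
  have hu1 : ∀ u : Fin 2 → Circle, (∏ i, (u i : ℂ) ^ ε₁ i) = u 1 := fun u => by
    simp [Fin.prod_univ_two, ε₁]
  have hnum : ∀ u : Fin 2 → Circle, ((u 0 : ℂ) - u 1) * Schur.character τ (diagonalTorusHom (Fin 2) u) =
      ∑ p ∈ Q, (e p : ℂ) * ∏ i, (u i : ℂ) ^ p i := fun u => by
    rw [hchar, sub_mul, ← hu0 u, ← hu1 u,
      sum_mul_prod_zpow_shift S d ε₀ Q Finset.subset_union_left hdS u,
      sum_mul_prod_zpow_shift S d ε₁ Q Finset.subset_union_right hdS u, ← Finset.sum_sub_distrib]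
    refine Finset.sum_congr rfl fun p _ => ?_
    simp only [he, Int.cast_sub, Int.cast_natCast, sub_mul]
  -- Parseval + Weyl: `Σ_{p ∈ Q} e_p² = 2`
  have hsum : ∑ p ∈ Q, e p ^ 2 = 2 := by
    have hW2 := integral_box_norm_sq_sub_mul_character τ hτ hu
    have hchart : ∀ θ : Fin 2 → ℝ, (cexp (θ 0 * I) - cexp (θ 1 * I)) *
        Schur.character τ (diagonalTorusHom (Fin 2) fun j => Circle.exp (θ j)) =
          ∑ p ∈ Q, (e p : ℂ) * cexp ((∑ j, (p j : ℂ) * (θ j : ℂ)) * I) := fun θ => by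
      have h := hnum fun j => Circle.exp (θ j)
      simp only [Circle.coe_exp] at h
      rw [h]
      refine Finset.sum_congr rfl fun p _ => ?_
      rw [← prod_coe_exp_zpow]
      simp only [Circle.coe_exp]
    simp_rw [hchart] at hW2
    rw [TorusBox.integral_box_norm_sq_trigPoly, Fintype.card_fin] at hW2
    have h2 : ∑ p ∈ Q, ‖(e p : ℂ)‖ ^ 2 = 2 := by
      have hpos : (0 : ℝ) < (2 * π) ^ 2 := by positivity
      nlinarith
    simp_rw [Complex.norm_intCast, sq_abs] at h2
    exact_mod_cast h2
  -- hence `e = δ_A − δ_{A∘swap}`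
  obtain ⟨A, hA1, hAne, heA⟩ := eq_indicator_sub_indicator_of_sum_sq_eq_two Q e heQ hanti hsum
  have hA01 : A 0 ≠ A 1 := by
    intro h
    apply hAne
    funext i; fin_cases i <;> simp [h]
  have hAQ : A ∈ Q := by by_contra h; have := heQ A h; omega
  have hAσQ : A ∘ Equiv.swap 0 1 ∈ Q := by
    by_contra h; have := heQ _ h; rw [hanti] at this; omega
  refine ⟨A, hA01, fun u => ?_, ?_⟩
  · rw [hnum u]
    simp_rw [heA, Int.cast_sub, sub_mul, Finset.sum_sub_distrib]
    simp only [Int.cast_ite, Int.cast_one, Int.cast_zero, ite_mul, one_mul, zero_mul, Finset.sum_ite_eq', if_pos hAQ,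
      if_pos hAσQ]
  · -- the weight `A − ε₀` occurs: `e_A = d_{A−ε₀} − d_{A−ε₁} = 1`
    have hdA : d (A - ε₀) ≠ 0 := by
      intro h
      have : e A = (d (A - ε₀) : ℤ) - d (A - ε₁) := rfl
      rw [hA1, h] at this
      omega
    have hWA : W (A - ε₀) ≠ ⊥ := fun h => hdA (Submodule.finrank_eq_zero.mpr h)
    obtain ⟨x, hx0, hx⟩ := (TorusWeights.weightSpace_ne_bot_iff ρ (A - ε₀)).mp hWA
    refine ⟨x, hx0, fun u => ?_⟩
    have h := hx u
    have hprod : (∏ i, (u i : ℂ) ^ (A - ε₀) i) = (u 0 : ℂ) ^ (A 0 - 1) * (u 1 : ℂ) ^ A 1 := by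
      simp [Fin.prod_univ_two, ε₀]
    rw [hprod] at h
    exact_mod_cast h

end Main

end UnitaryTwo

end Literature.RepresentationTheory.CompactGroups

end
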